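import Literature.NumberTheory.EllipticCurves.UnramifiedPrimeTwist
import Literature.NumberTheory.EllipticCurves.LocalTorsionCohomologyCoprime
import HarnessLib

/-!
# The Mazur–Rubin prime twist: the `𝔓`-Selmer local condition of `A_χ` is EVERYTHING at a place where
# `H¹(K_v, E[p]) = 0` — in particular at a finite `v ∤ p` with `E(K_v)[p] = 0`, where it then AGREES with `E`'s

`Proofs` file (theorems only: no definition, no named fact, no `sorry`), sequel of `PrimeTwistLocalConditionSplitPlace.lean`
(the split places). The `𝔓`-Selmer local condition `PrimeTwist.selmerLocalKer W χ F` of Mazur–Rubin 2007 Def. 4.3 is the kernel of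
`H¹(K, E[p]) → H¹(F, A_χ)` along `E[p] = A_χ[𝔓] ⊆ A_χ`; it factors through the restriction `res_F : H¹(K, E[p]) → H¹(Γ_F, E[p])`, so
it contains `ker res_F`, and it is ALL of `H¹(K, E[p])` whenever `H¹(Γ_F, E[p]) = 0`:

* `PrimeTwist.mem_selmerLocalKer_of_res_eq_zero` — `res_F c = 0 ⟹ c ∈ PrimeTwist.selmerLocalKer W χ F` (cocycle criterion);
* `PrimeTwist.mem_selmerLocalKer_adicCompletion_of_forall_nsmul_eq_zero`, `…_eq_top_…` — at a finite place `v ∤ p` with `E(K_v)[p] = 0`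
  (then `H¹(K_v, E[p]) = 0` unconditionally: the tree's `subsingleton_galoisCohomology_one_torsion_adicCompletion_of_forall_nsmul_eq_zero`,
  Milne I Cor. 2.3 + Thm. 2.8 prime-to-`p`) EVERY class lies in the `𝔓`-Selmer local condition at `K_v`;
* **`PrimeTwist.selmerLocalKer_adicCompletion_eq_of_forall_nsmul_eq_zero`** — hence there `PrimeTwist.selmerLocalKer W χ K_v = W.selmerLocalKer K_v p`
  (both are `⊤`; `E`'s side is the tree's `selmerLocalKer_adicCompletion_eq_top_of_forall_nsmul_eq_zero`).

For `p = 2` over `ℚ` and `χ = χ_d` this is the row «`q ∣ d` good with `a_q(E)` odd (`E(ℚ_q)[2] = 0`): both local conditions are the whole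
`H¹`, i.e. impose nothing» of the cell `bsd-f1-sign2`'s DESC-§17 dictionary (`F1Sign2.TwistSelmerEqRelaxedAtInfinityAtTwo`, Mazur–Rubin 2010
§3 `T`-places with `E(K_v)[2] = 0` are silent). KNOWN in print; kernel-new.

## References
* [MazurRubin2007] B. Mazur, K. Rubin, *Finding large Selmer rank via an arithmetic theory of local constants*, Ann. of Math. 166 (2007):
  Def. 4.3, Cor. 4.6, §5.
* [MilneADT2006] J. S. Milne, *Arithmetic Duality Theorems*, 2nd ed., I Cor. 2.3, Thm. 2.8.
-/

noncomputable section

open scoped Classical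
open scoped AddSubgroup

universe u

namespace Literature.NumberTheory.EllipticCurves

namespace PrimeTwist

open NumberField IsDedekindDomain GaloisRepresentations

variable {K : Type u} [Field K] (W : WeierstrassCurve K) {p : ℕ} [Fact p.Prime]
variable (χ : Field.absoluteGaloisGroup K →ₜ* Multiplicative (ZMod p))

/-- **`ker res_F ≤ H¹_𝒜(K_v)`**: a class of `H¹(K, E[p])` whose restriction to `Γ_F` vanishes (already in `H¹(Γ_F, E[p])`) lies in the
`𝔓`-Selmer local condition of `A_χ` at `F` — push the bounding cochain `P ∈ E[p]` along `E[p] → A_χ(K̄) → A_χ(K̄_F)` (equivariant).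
[cite: MazurRubin2007, Def 4.3] -/
theorem mem_selmerLocalKer_of_res_eq_zero (F : Type u) [Field F] [Algebra K F] {c : W.galH1Torsion (p : ℤ)}
    (hc : galoisCohomology.res (W.torsionGaloisModule (p : ℤ)) F 1 c = 0) : c ∈ selmerLocalKer W χ F := by
  obtain ⟨φ, rfl⟩ := oneCocycleClass_surjective
    (discreteTopRep (Field.absoluteGaloisGroup K) (W.geomTorsion (p : ℤ))) c
  rw [WeierstrassCurve.res_torsionGaloisModule_oneCocycleClass] at hc
  obtain ⟨P, hP⟩ := (oneCocycleClass_eq_zero_iff _ _).mp hc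
  rw [selmerLocalKer, oneCocycleClass_mem_resKer_iff]
  refine ⟨(locMap W χ F).comp (constEmb _ W.geomPoints) P, fun g ↦ ?_⟩
  have h1 : φ.1 (resGal (K := K) F g) = resGal (K := K) F g • P - P := by
    rw [WeierstrassCurve.resGal_eq_absGaloisRestrict]; exact hP g
  rw [h1, map_sub, AddMonoidHom.comp_apply, AddMonoidHom.comp_apply]
  -- `P` is a point of `E[p]` seen in the restricted module; the constant embedding and the localisation are equivariant
  change locMap W χ F (constEmb _ W.geomPoints (resGal (K := K) F g • (P : W.geomTorsion (p : ℤ)))) - _ = _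
  rw [constEmb_smul, locMap_smul]

variable [NumberField K] [W.IsElliptic] (v : HeightOneSpectrum (𝓞 K))

/-- **At a finite `v ∤ p` with `E(K_v)[p] = 0` EVERY class of `H¹(K, E[p])` lies in the `𝔓`-Selmer local condition of `A_χ` at `K_v`**
(`H¹(K_v, E[p]) = 0` there, unconditionally: Milne I Cor. 2.3 + Thm. 2.8 prime to `p`, tree
`subsingleton_galoisCohomology_one_torsion_adicCompletion_of_forall_nsmul_eq_zero`). [cite: MazurRubin2007, Def 4.3]
[cite: MilneADT2006, Ch. I, Cor. 2.3 and Thm. 2.8] -/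
theorem mem_selmerLocalKer_adicCompletion_of_forall_nsmul_eq_zero (hv : ((p : ℕ) : 𝓞 K) ∉ v.asIdeal)
    (htors : ∀ P : (W.baseChange (v.adicCompletion K)).toAffine.Point, p • P = 0 → P = 0)
    (c : W.galH1Torsion (p : ℤ)) : c ∈ selmerLocalKer W χ (v.adicCompletion K) := by
  haveI := subsingleton_galoisCohomology_one_torsion_adicCompletion_of_forall_nsmul_eq_zero W v p hv htors
  exact mem_selmerLocalKer_of_res_eq_zero W χ (v.adicCompletion K) (Subsingleton.elim _ _)

/-- Top form: **`PrimeTwist.selmerLocalKer W χ K_v = ⊤`** at a finite `v ∤ p` with `E(K_v)[p] = 0`. [cite: MazurRubin2007, Def 4.3]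
[cite: MilneADT2006, Ch. I, Cor. 2.3 and Thm. 2.8] -/
theorem selmerLocalKer_adicCompletion_eq_top_of_forall_nsmul_eq_zero (hv : ((p : ℕ) : 𝓞 K) ∉ v.asIdeal)
    (htors : ∀ P : (W.baseChange (v.adicCompletion K)).toAffine.Point, p • P = 0 → P = 0) :
    selmerLocalKer W χ (v.adicCompletion K) = ⊤ :=
  eq_top_iff.mpr fun c _ ↦ mem_selmerLocalKer_adicCompletion_of_forall_nsmul_eq_zero W χ v hv htors c

/-- **THE LOCAL COMPARISON AT A PLACE WITHOUT `p`-TORSION: `H¹_𝒜(K_v, E[p]) = H¹_f(K_v, E[p])` (both `= H¹(K, E[p])`, i.e. no condition)**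
at a finite `v ∤ p` with `E(K_v)[p] = 0` — the hypothesis `hv v` of `PrimeTwist.selmerGroup_eq_selmerGroup` at such places, whatever the
behaviour of `χ` at `v` (split, inert or RAMIFIED: for `p = 2`, `χ = χ_d`, the primes `q ∣ d` with `a_q(E)` odd).
[cite: MazurRubin2007, Def 4.3 and Cor 4.6] [cite: MilneADT2006, Ch. I, Cor. 2.3 and Thm. 2.8] -/
theorem selmerLocalKer_adicCompletion_eq_of_forall_nsmul_eq_zero (hv : ((p : ℕ) : 𝓞 K) ∉ v.asIdeal)
    (htors : ∀ P : (W.baseChange (v.adicCompletion K)).toAffine.Point, p • P = 0 → P = 0) :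
    selmerLocalKer W χ (v.adicCompletion K) = W.selmerLocalKer (v.adicCompletion K) p := by
  rw [selmerLocalKer_adicCompletion_eq_top_of_forall_nsmul_eq_zero W χ v hv htors,
    W.selmerLocalKer_adicCompletion_eq_top_of_forall_nsmul_eq_zero v p hv htors]

end PrimeTwist

end Literature.NumberTheory.EllipticCurves

end
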